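import Summits.QuantumFields.YangMills.Theorems.IR.BlockedActivityW
import Summits.QuantumFields.YangMills.Theorems.IR.AfPincerUcSharpOnsetSuppliers
import HarnessLib

/-!
# Crux `IR` (stmt-QuantumFields-19354), lane B «strong coupling AFTER BLOCKING»: the onset ∕ construction statements in the REPAIRED W-currency
# and their registered targets BY NAME (part 2/2; owner R103 (b), R106 (1)(3), R100 (3), R95)

Helper module for item `stmt-QuantumFields-19354` (`--supports`; it closes nothing), lane `ym-19354-onsetsc-p2`.  Every statement below is OPEN research
content (complete-analyticity strength for simply connected compact simple `G`; no source), typed — per R106 (1) — in the W-currency of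
`Theorems/IR/BlockedActivityW` only; they SUPERSEDE the σ-uniform statements of p527934 ∕ p533919 ∕ p534686.

* `BlockedActivityOnsetSCW` (uncalibrated) ⇒ `OnsetFormatsUc.OnsetMixingTypicalUKPcSC` (`onsetMixingTypicalUKPcSC_of_blockedActivityOnsetSCW`, via p524177).
* `BlockedActivityOnsetCalSCW` (NT-calibrated mesh `a β · b < T`, R100 (3)) ⇒ `SharpOnset.UnivOnsetSharpSC` ⇒ with `IRNSC` the ROUTE DECL:
  **`ir_of_blockedActivityOnsetCalSCW : BlockedActivityOnsetCalSCW → SharpOnset.IRNSC → Theses.BalabanLadder.IR`** (NO X-stub; registered target of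
  record `stub_onsetSharpSC` through cplan's glue); EXPOSED by name to the uniform wire (`not_blockedActivityOnsetCalSCW_of_uniformWire`), NOT to the central flip.
* `BlockedActivityTypOnsetCalSCW` (W|Typ, hereditary (6d) shape) ⇒ **`ir_of_blockedActivityTypOnsetCalSCW`** (cplan (6d) instantiated with
  `Act := BlockedActivityTypWAll`, `r₀ := radiusT`); `blockedActivityTypOnsetCalSCW_of_calW`.
* `BlockedActivityWorkingClassCalSCW` (on the LEAD's working class + `SupCellRarityAt`, (6d-wc) shape) ⇒ **`ir_of_blockedActivityWorkingClassCalSCW`**.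

SUPPLIER OBLIGATION (owner R107, ctriage-1 O-118.1): whoever PROVES `BlockedActivityTypOnsetCalSCW` must NAME its `Typ` and make it SHORT-CHAIN
TOLERANT (membership invariant under bad chains of length `≤ ℓ₀`, `8 ℓ₀ ≤ b`), with clause (i) stated for collars carrying such chains — a `Typ` forbidding
all bad chains fails (ii) at AF scales.  The `∃ Typ` here stays free (as in I♯_SC); the working-class variant names `Typ := WorkingClass` (lane A's class,
whose tolerance is lane A's to certify).  No tree currency for «short-chain tolerant» exists yet; not typed here.

HONEST FRAMING: reductions among OPEN statements of a CONDITIONAL chain; nothing registered is moved; not mixing, not a gap, not Clay.  No `sorry`;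
axioms ⊆ {propext, Classical.choice, Quot.sound}.
-/

set_option autoImplicit false

noncomputable section

open Filter Topology MeasureTheory
open Literature.MathematicalPhysics.QuantumFieldTheory Literature.MathematicalPhysics.QuantumLattice
open Literature.Probability.LatticeModels (IsLocalPerturbation)
open Summit.QuantumFields.YangMills.Cruxes.OSLegsFromFemtoAndGap.DlrCollarTransfer (LowerBounds)
open Summit.QuantumFields.YangMills.Cruxes.IR.Tempered (cellEdges windowCells regionEdges collarEdges)
open Summit.QuantumFields.YangMills.Cruxes.IR.ShellTempered (windowCellsPlus)
open Summit.QuantumFields.YangMills.Cruxes.IR.OnsetFormats (shellCount UnivShellCond)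
open Summit.QuantumFields.YangMills.Cruxes.IR.OnsetFormatsUc (OnsetMixingTypicalUKPcSC)
open Summit.QuantumFields.YangMills.Cruxes.IR.FixedMesh (ClauseI)
open Summit.QuantumFields.YangMills.Cruxes.IR.AfPincerUc (ClauseIAll IsFrame TypLocal ClauseIIukp ClauseIII)
open Summit.QuantumFields.YangMills.Cruxes.IR.CellTempered.Engine (shiftFrame)
open Summit.QuantumFields.YangMills.Theorems.IRTypLocalExcess (WorkingClass)
open Summit.QuantumFields.YangMills.Cruxes.IR.AfPincerUc.Supplier (SupCellRarityAt)
open Summit.QuantumFields.YangMills.Cruxes.IR.AfPincerUc.SharpOnset (IRNSC UnivOnsetSharpSC ir_of_univOnsetSharpSC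
  not_univOnsetSharpSC_of_uniformWire ir_of_activitySupplierHereditarySharpSC ir_of_activitySupplierSharpSC)

namespace Summit.QuantumFields.YangMills.Cruxes.IR.BlockedActivity

/-- **Construction statement, W-currency, SC family (uncalibrated).**  OPEN; not asserted. -/
def BlockedActivityOnsetSCW : Prop :=
  ∀ (G : Type) [Group G] [TopologicalSpace G] [IsTopologicalGroup G] [CompactSpace G],
    IsCompactSimpleLieGroup G → SimplyConnectedSpace G →
    letI : MeasurableSpace G := borel G; haveI : BorelSpace G := ⟨rfl⟩;
    ∀ r : LatticeRep G, BlockedActivityOnsetAtW r.ρ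

/-- **Construction statement, W-currency, NT-CALIBRATED mesh (owner R100 (3)).**  OPEN; not asserted. -/
def BlockedActivityOnsetCalSCW : Prop :=
  ∀ (G : Type) [Group G] [TopologicalSpace G] [IsTopologicalGroup G] [CompactSpace G],
    IsCompactSimpleLieGroup G → SimplyConnectedSpace G →
    letI : MeasurableSpace G := borel G; haveI : BorelSpace G := ⟨rfl⟩;
    ∀ (r : LatticeRep G) (a : ℝ → ℝ), (∀ β, 0 < a β) → Tendsto a atTop (𝓝 0) → LowerBounds G r a →
      ∀ act : ℝ, 0 < act → ∃ T β₂ : ℝ, ∀ β : ℝ, β₂ ≤ β → ∃ b : ℕ, 1 ≤ b ∧ a β * (b : ℝ) < T ∧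
        BlockedActivityClassW r.ρ β b 1 act

/-- **Construction statement, W|Typ-currency, NT-calibrated, hereditary (cplan (6d) `hcons` with `Act := BlockedActivityTypWAll`, `r₀ n ε := radiusT ε`).**
OPEN; not asserted; NOT exposed to the uniform wire nor to the central flip. -/
def BlockedActivityTypOnsetCalSCW : Prop :=
  ∀ (G : Type) [Group G] [TopologicalSpace G] [IsTopologicalGroup G] [CompactSpace G],
    IsCompactSimpleLieGroup G → SimplyConnectedSpace G →
    letI : MeasurableSpace G := borel G; haveI : BorelSpace G := ⟨rfl⟩;
    ∀ (r : LatticeRep G) (a : ℝ → ℝ), (∀ β, 0 < a β) → Tendsto a atTop (𝓝 0) → LowerBounds G r a →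
      ∃ (n : ℕ) (ε : ℝ), 1 ≤ n ∧ 0 ≤ ε ∧ ε * shellCount n ≤ 3 / 4 ∧
        ∀ δ : ℝ, 0 < δ → ∃ T β₂ : ℝ, ∀ β : ℝ, β₂ ≤ β → ∃ b : ℕ, 1 ≤ b ∧ a β * (b : ℝ) < T ∧
          ∀ w : Fin 4 → ℤ → ℤ, IsFrame b w → ∃ Typ : (Fin 4 → ℤ) → Set (LGConfig 4 G),
            TypLocal w Typ ∧ BlockedActivityTypWAll r.ρ β w n (radiusT ε) Typ ∧ ClauseIIukp r.ρ β w δ Typ ∧ ClauseIII r.ρ β w b δ Typ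

/-- **Construction statement on the LEAD's working class, W-currency (cplan (6d-wc) `hcons` with `Act := BlockedActivityTypW`, `r₀ n ε := radiusT ε`).**
OPEN; not asserted. -/
def BlockedActivityWorkingClassCalSCW : Prop :=
  ∀ (G : Type) [Group G] [TopologicalSpace G] [IsTopologicalGroup G] [CompactSpace G],
    IsCompactSimpleLieGroup G → SimplyConnectedSpace G →
    letI : MeasurableSpace G := borel G; haveI : BorelSpace G := ⟨rfl⟩;
    ∀ (r : LatticeRep G) (a : ℝ → ℝ), (∀ β, 0 < a β) → Tendsto a atTop (𝓝 0) → LowerBounds G r a →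
      ∃ (n : ℕ) (ε : ℝ), 1 ≤ n ∧ 0 ≤ ε ∧ ε * shellCount n ≤ 3 / 4 ∧
        ∀ δ : ℝ, 0 < δ → ∃ T β₂ : ℝ, ∀ β : ℝ, β₂ ≤ β → ∃ b : ℕ, 1 ≤ b ∧ a β * (b : ℝ) < T ∧
          ∃ (ℓ : ℕ) (T' : ℝ) (Rs : Set ℕ) (E : ℕ → ℝ), ∀ w : Fin 4 → ℤ → ℤ, OnsetFormatsUc.IsFrame b w →
            BlockedActivityTypW r.ρ β w n (radiusT ε) (WorkingClass r.ρ ℓ T' Rs E w) ∧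
              SupCellRarityAt r.ρ β w (WorkingClass r.ρ ℓ T' Rs E w) δ

/-! ## §4 Onset statements in W-currency ⇒ the registered targets BY NAME -/

section Onset

variable {G : Type} [Group G] [TopologicalSpace G] [IsTopologicalGroup G] [CompactSpace G]
  [MeasurableSpace G] [BorelSpace G] {N : ℕ} {ρ : G →* Matrix (Fin N) (Fin N) ℂ}

/-- Per group: a W-onset gives a universal onset at window `1` with `ε = 1/3552`. -/
theorem univOnsetAt_of_blockedActivityOnsetAtW (h : BlockedActivityOnsetAtW ρ) :
    ∃ β₂ : ℝ, ∀ β : ℝ, β₂ ≤ β → ∃ b : ℕ, 1 ≤ b ∧ UnivShellCond ρ β b 1 (1 / 3552) := by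
  obtain ⟨β₂, hβ⟩ := h (radius (1 / 3552)) (radius_pos (by norm_num))
  refine ⟨β₂, fun β hb => ?_⟩
  obtain ⟨b, hb1, hC⟩ := hβ β hb
  exact ⟨b, hb1, univShellCond_of_blockedActivityW hC (by norm_num) le_rfl⟩

end Onset

/-- **`BlockedActivityOnsetSCW → OnsetFormatsUc.OnsetMixingTypicalUKPcSC`** (the statement of the de-registered `stub_onsetUcSC`, via p524177). -/
theorem onsetMixingTypicalUKPcSC_of_blockedActivityOnsetSCW (h : BlockedActivityOnsetSCW) : OnsetMixingTypicalUKPcSC := by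
  refine AfPincerUc.SupplierSC.onsetMixingTypicalUKPcSC_of_univOnsetSC fun G _ _ _ _ hG hsc => ?_
  letI : MeasurableSpace G := borel G
  haveI : BorelSpace G := ⟨rfl⟩
  intro r
  refine ⟨1, 1 / 3552, le_rfl, by norm_num, by rw [shellCount_one]; norm_num, ?_⟩
  exact univOnsetAt_of_blockedActivityOnsetAtW (h G hG hsc r)

/-- **Calibrated W ⇒ the universal sharp currency** `SharpOnset.UnivOnsetSharpSC` at `(n, ε) = (1, 1/3552)`. -/
theorem univOnsetSharpSC_of_blockedActivityOnsetCalSCW (h : BlockedActivityOnsetCalSCW) : UnivOnsetSharpSC := by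
  intro G _ _ _ _ hG hsc
  letI : MeasurableSpace G := borel G
  haveI : BorelSpace G := ⟨rfl⟩
  intro r a ha hat hlb
  have hε : (0 : ℝ) < 1 / 3552 := by norm_num
  obtain ⟨T, β₂, hb⟩ := h G hG hsc r a ha hat hlb (radius (1 / 3552)) (radius_pos hε)
  refine ⟨1, 1 / 3552, le_rfl, hε.le, ?_, T, β₂, fun β hβ => ?_⟩
  · rw [shellCount_one]; norm_num
  · obtain ⟨b, hb1, hlt, hC⟩ := hb β hβ
    exact ⟨b, hb1, hlt, univShellCond_of_blockedActivityW hC (by norm_num) le_rfl⟩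

/-- **Calibrated W ∧ R_NSC ⇒ the route decl `IR`, NO X-stub** (registered target of record: `stub_onsetSharpSC` ∕ I♯_SC via cplan's glue). -/
theorem ir_of_blockedActivityOnsetCalSCW (h : BlockedActivityOnsetCalSCW) (hN : IRNSC) :
    Summit.QuantumFields.YangMills.Theses.BalabanLadder.IR :=
  ir_of_univOnsetSharpSC (univOnsetSharpSC_of_blockedActivityOnsetCalSCW h) hN

/-- Exposure of the calibrated σ-agreement-uniform statement to the uniform wire (by name; NOT to the central flip). -/
theorem not_blockedActivityOnsetCalSCW_of_uniformWire (G : Type) [Group G] [TopologicalSpace G] [IsTopologicalGroup G]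
    [CompactSpace G] (hG : IsCompactSimpleLieGroup G) (hsc : SimplyConnectedSpace G)
    (hW : letI : MeasurableSpace G := borel G; haveI : BorelSpace G := ⟨rfl⟩;
      ∃ r : LatticeRep G, OnsetWire.UniformWire r.ρ ∧
        ∃ a : ℝ → ℝ, (∀ β, 0 < a β) ∧ Tendsto a atTop (𝓝 0) ∧ LowerBounds G r a) : ¬ BlockedActivityOnsetCalSCW :=
  fun h => not_univOnsetSharpSC_of_uniformWire G hG hsc hW (univOnsetSharpSC_of_blockedActivityOnsetCalSCW h)

/-- **W|Typ calibrated ∧ R_NSC ⇒ `IR`** (cplan (6d) instantiated with `Act := BlockedActivityTypWAll`, `r₀ := radiusT`). -/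
theorem ir_of_blockedActivityTypOnsetCalSCW (h : BlockedActivityTypOnsetCalSCW) (hN : IRNSC) :
    Summit.QuantumFields.YangMills.Theses.BalabanLadder.IR :=
  ir_of_activitySupplierHereditarySharpSC (Act := @BlockedActivityTypWAll) (r₀ := fun _ ε => radiusT ε)
    (hadapt := fun _ _ _ _ _ _ hA => clauseIAll_of_blockedActivityTypWAll_radiusT hA) h hN

/-- **W on the working class ∧ R_NSC ⇒ `IR`** (cplan (6d-wc) instantiated with `Act := BlockedActivityTypW`, `r₀ := radiusT`). -/
theorem ir_of_blockedActivityWorkingClassCalSCW (h : BlockedActivityWorkingClassCalSCW) (hN : IRNSC) :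
    Summit.QuantumFields.YangMills.Theses.BalabanLadder.IR :=
  ir_of_activitySupplierSharpSC (Act := @BlockedActivityTypW) (r₀ := fun _ ε => radiusT ε)
    (hadapt := fun _ _ _ _ _ _ hA => clauseI_of_blockedActivityTypW_radiusT hA) h hN

/-- The σ-agreement-uniform calibrated W statement implies the W|Typ one (class `Typ ≡ univ`). -/
theorem blockedActivityTypOnsetCalSCW_of_calW (h : BlockedActivityOnsetCalSCW) : BlockedActivityTypOnsetCalSCW := by
  intro G _ _ _ _ hG hsc
  letI : MeasurableSpace G := borel G
  haveI : BorelSpace G := ⟨rfl⟩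
  intro r a ha hat hlb
  have hε : (0 : ℝ) < 1 / 3552 := by norm_num
  obtain ⟨T, β₂, hb⟩ := h G hG hsc r a ha hat hlb (radiusT (1 / 3552)) (radiusT_pos hε)
  refine ⟨1, 1 / 3552, le_rfl, hε.le, ?_, fun δ hδ => ⟨T, β₂, fun β hβ => ?_⟩⟩
  · rw [shellCount_one]; norm_num
  · obtain ⟨b, hb1, hlt, hC⟩ := hb β hβ
    refine ⟨b, hb1, hlt, fun w hw => ⟨fun _ => Set.univ, ?_, ?_, ?_, ?_⟩⟩
    · exact ⟨fun _ => MeasurableSet.univ, fun _ _ _ _ => by simp⟩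
    · intro c₀
      exact blockedActivityTypW_of_blockedActivityClassW hC
        (Summit.QuantumFields.YangMills.Cruxes.IR.CellTempered.Engine.shiftFrame_mesh hw c₀) _
    · intro F F' _ hF ζ _
      obtain ⟨c, hc⟩ := hF
      refine (measure_mono (t := (∅ : Set (LGConfig 4 G))) fun σ hσ => ?_).trans (by simp)
      exact (hσ c hc (Set.mem_univ _)).elim
    · intro S _ F hF _
      obtain ⟨c, hc⟩ := hF
      refine (measure_mono (t := (∅ : Set (GaugeConfig 4 (2 * S + 1) G))) fun V hV => ?_).trans (by simp)
      exact (hV c hc (Set.mem_univ _)).elim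

end Summit.QuantumFields.YangMills.Cruxes.IR.BlockedActivity

end
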